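import Summits.QuantumFields.YangMills.Theorems.BalabanLadderNTStrongCouplingLongTubeDefs
import Summits.QuantumFields.YangMills.Theorems.ChatterjeeMassGapTorusAxialDistanceTwoSlabs
import HarnessLib

/-!
# Crux `NT` (stmt-QuantumFields-19353), strong-coupling rungs: the temporal tube of ANY length — levels, cardinality
# `4n + 2`, the faces at the two observed sites (incidences), and the corner region

Helper file of the fleet lead prover of crux `NT` (unit `ym-spine-19353-p1`, g27), part I of the length-generic tube
toolkit over `…LongTubeDefs` (the literal `n = 2` / `n = 4` versions are `MirrorJet` / `…HigherMirrorTubes`, by kernel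
computation; here structural proofs for every `n`):

* `time_of_mem_tubeSides`, `time_of_mem_openTube`, `time_bounds_of_mem_longTube` — sides are temporal, based at the
  level times `z 0 + k`, `k < n`; every face is based in `[z 0, z 0 + n]`;
* `tubeSides_card = 4`, `longTube_card = 4n + 2` (`n ≥ 1`), `card_of_mem_longTubes` — the `hc` input of
  `LongTube.pair_jet_of_class_conn`;
* `mk_top_mem_longTube_iff` — the only face based at the top site `z + n e₀` is the top cap; `mk_bot_mem_longTube_iff` — the
  faces based at the bottom site `z` are the bottom cap and the two sides `(z; 0,a₁)`, `(z; 0,a₂)` (so each tube meets a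
  mirror pair `((z + n e₀; a'), (z; b'))` in `1 × 3` ways: nine incidences over the three tubes, as at `n = 2, 4`);
  `mk_top_ne_mk_bot`;
* `mk_mem_plaqSet`, `longTube_subset_plaqSet`, `longTubes_subset_plaqSet` — the tubes are plaquette families of every
  region containing their corners (`tubeCorners` / `longTubeRegion`).

HONEST FRAMING: lattice combinatorics only; nothing about measures, `β`, NT or the gap. [folklore]
-/

/-! ## Part I — combinatorics of the tube of any length: levels, cardinality, incidences, region -/

namespace Summit.QuantumFields.YangMills.Cruxes.NT.StrongCouplingRung.LongTube

open Finset
open Literature.Probability.LatticeModels (Site)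
open Literature.MathematicalPhysics.QuantumLattice (ZdEdge ZdPlaquette plaquetteEdges)
open Literature.MathematicalPhysics.QuantumFieldTheory (plaqSet plaquettesIn IsParallel)
open Summit.QuantumFields.YangMills.Theorems (S28DistanceTwo.add_single_ne)

variable {z y : Site 4} {n : ℕ} {a : {q : Fin 4 × Fin 4 // q.1 < q.2}} {ha : (0 : Fin 4) < a.1.1}

/-! ### Small distinctness facts -/

/-- The two side orientations `(0, a₁) ≠ (0, a₂)`. [folklore] -/
theorem sideOrient_ne (a : {q : Fin 4 × Fin 4 // q.1 < q.2}) (ha : (0 : Fin 4) < a.1.1) :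
    (⟨(0, a.1.1), ha⟩ : {q : Fin 4 × Fin 4 // q.1 < q.2}) ≠ ⟨(0, a.1.2), ha.trans a.2⟩ := by
  intro h
  have := congrArg (fun q : {q : Fin 4 × Fin 4 // q.1 < q.2} => q.1.2) h
  exact absurd this (ne_of_lt a.2)

/-- The cap orientation differs from the first side orientation. [folklore] -/
theorem capOrient_ne_side₁ (a : {q : Fin 4 × Fin 4 // q.1 < q.2}) (ha : (0 : Fin 4) < a.1.1) :
    a ≠ ⟨(0, a.1.1), ha⟩ := by
  intro h
  have := congrArg (fun q : {q : Fin 4 × Fin 4 // q.1 < q.2} => q.1.1) h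
  exact absurd this.symm (ne_of_lt ha)

/-- The cap orientation differs from the second side orientation. [folklore] -/
theorem capOrient_ne_side₂ (a : {q : Fin 4 × Fin 4 // q.1 < q.2}) (ha : (0 : Fin 4) < a.1.1) :
    a ≠ ⟨(0, a.1.2), ha.trans a.2⟩ := by
  intro h
  have := congrArg (fun q : {q : Fin 4 × Fin 4 // q.1 < q.2} => q.1.1) h
  exact absurd this.symm (ne_of_lt ha)

/-- Time coordinate of a level: `(z + k e₀) 0 = z 0 + k`. [folklore] -/
theorem level_apply_zero (z : Site 4) (k : ℤ) : (z + Pi.single (0 : Fin 4) k : Site 4) 0 = z 0 + k := by simp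

/-- A spatial unit step does not change the time coordinate. [folklore] -/
theorem add_single_apply_zero_of_pos (y : Site 4) {m : Fin 4} (hm : (0 : Fin 4) < m) :
    (y + Pi.single m (1 : ℤ) : Site 4) 0 = y 0 := by
  simp [Pi.single_eq_of_ne (ne_of_lt hm)]

/-- Consecutive levels: `z + k e₀ + e₀ = z + (k+1) e₀`. [folklore] -/
theorem level_succ (z : Site 4) (k : ℕ) :
    z + Pi.single 0 (k : ℤ) + Pi.single 0 1 = z + Pi.single 0 ((k + 1 : ℕ) : ℤ) := by
  rw [add_assoc, ← Pi.single_add]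
  push_cast
  rfl

/-! ### Sides: base time, temporality, cardinality -/

/-- Every side over `(y; a)` is a temporal plaquette based at time `y 0`. [folklore] -/
theorem time_of_mem_tubeSides {p : ZdPlaquette 4} (hp : p ∈ tubeSides y a ha) : p.1 0 = y 0 ∧ p.2.1.1 = 0 := by
  rw [mem_tubeSides] at hp
  rcases hp with rfl | rfl | rfl | rfl
  · exact ⟨rfl, rfl⟩
  · exact ⟨add_single_apply_zero_of_pos y (ha.trans a.2), rfl⟩
  · exact ⟨rfl, rfl⟩
  · exact ⟨add_single_apply_zero_of_pos y ha, rfl⟩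

/-- The four sides are four. [folklore] -/
theorem tubeSides_card (y : Site 4) (a : {q : Fin 4 × Fin 4 // q.1 < q.2}) (ha : (0 : Fin 4) < a.1.1) :
    (tubeSides y a ha).card = 4 := by
  have h12 := sideOrient_ne a ha
  unfold tubeSides
  rw [card_insert_of_notMem, card_insert_of_notMem, card_pair]
  · intro h
    exact S28DistanceTwo.add_single_ne y a.1.1 (congrArg Prod.fst h).symm
  · simp only [mem_insert, mem_singleton, Prod.mk.injEq, not_or]
    exact ⟨fun h => h12 h.2, fun h => h12 h.2⟩
  · simp only [mem_insert, mem_singleton, Prod.mk.injEq, not_or]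
    exact ⟨fun h => S28DistanceTwo.add_single_ne y a.1.2 h.1.symm, fun h => h12 h.2, fun h => h12 h.2⟩

/-- The caps are not sides (a cap is not temporal). [folklore] -/
theorem cap_notMem_tubeSides (x y : Site 4) (a : {q : Fin 4 × Fin 4 // q.1 < q.2}) (ha : (0 : Fin 4) < a.1.1) :
    ((x, a) : ZdPlaquette 4) ∉ tubeSides y a ha := by
  intro h
  have := (time_of_mem_tubeSides h).2
  exact absurd this (ne_of_gt ha)

/-- Sides at different levels are disjoint. [folklore] -/
theorem disjoint_tubeSides_of_ne {k k' : ℕ} (hkk' : k ≠ k') :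
    Disjoint (tubeSides (z + Pi.single 0 (k : ℤ)) a ha) (tubeSides (z + Pi.single 0 (k' : ℤ)) a ha) := by
  rw [Finset.disjoint_left]
  intro p hp hp'
  have h1 := (time_of_mem_tubeSides hp).1
  have h2 := (time_of_mem_tubeSides hp').1
  rw [level_apply_zero] at h1 h2
  omega

/-- The sides of the tube are `4n`. [folklore] -/
theorem card_biUnion_tubeSides (z : Site 4) (n : ℕ) (a : {q : Fin 4 × Fin 4 // q.1 < q.2})
    (ha : (0 : Fin 4) < a.1.1) :
    ((range n).biUnion fun k => tubeSides (z + Pi.single 0 (k : ℤ)) a ha).card = 4 * n := by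
  rw [card_biUnion (fun k _ k' _ hkk' => disjoint_tubeSides_of_ne hkk')]
  simp [tubeSides_card, mul_comm]

/-! ### The tube: levels and cardinality -/

/-- Every member of the open tube other than the top cap is a temporal side at a level `k < n`. [folklore] -/
theorem time_of_mem_openTube {p : ZdPlaquette 4} (hp : p ∈ openTube z n a ha) :
    p = (z + Pi.single 0 (n : ℤ), a) ∨ (p.2.1.1 = 0 ∧ ∃ k, k < n ∧ p.1 0 = z 0 + k ∧
      p ∈ tubeSides (z + Pi.single 0 (k : ℤ)) a ha) := by
  rw [mem_openTube] at hp
  rcases hp with h | ⟨k, hk, hp⟩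
  · exact Or.inl h
  · obtain ⟨h0, hpar⟩ := time_of_mem_tubeSides hp
    rw [level_apply_zero] at h0
    exact Or.inr ⟨hpar, k, hk, h0, hp⟩

/-- Time bounds in the tube: every member is based at a time in `[z 0, z 0 + n]`, the temporal ones below `z 0 + n`.
[folklore] -/
theorem time_bounds_of_mem_longTube {p : ZdPlaquette 4} (hp : p ∈ longTube z n a ha) :
    z 0 ≤ p.1 0 ∧ p.1 0 ≤ z 0 + n ∧ (p.2.1.1 = 0 → p.1 0 < z 0 + n) := by
  rw [longTube, mem_insert] at hp
  have hne : a.1.1 ≠ 0 := (ne_of_lt ha).symm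
  rcases hp with rfl | hp
  · exact ⟨le_rfl, by simp, fun h => absurd h hne⟩
  · rcases time_of_mem_openTube hp with rfl | ⟨-, k, hk, h0, -⟩
    · refine ⟨by simp, by simp, fun h => absurd h hne⟩
    · refine ⟨by omega, by omega, fun _ => by omega⟩

/-- Every member of the open tube is based at a time `≥ z 0`. [folklore] -/
theorem time_le_of_mem_openTube {p : ZdPlaquette 4} (hp : p ∈ openTube z n a ha) : z 0 ≤ p.1 0 := by
  rcases time_of_mem_openTube hp with rfl | ⟨-, k, -, h0, -⟩
  · simp
  · omega

/-- The bottom cap is not in the open tube (`n ≥ 1`). [folklore] -/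
theorem bot_notMem_openTube (hn : 1 ≤ n) : ((z, a) : ZdPlaquette 4) ∉ openTube z n a ha := by
  intro h
  rcases time_of_mem_openTube h with h | ⟨h, -⟩
  · have := congrFun (congrArg Prod.fst h) 0
    simp at this
    omega
  · exact absurd h (ne_of_gt ha)

/-- The bottom sides and the open tube one level up are disjoint (base times `z 0` versus `≥ z 0 + 1`). [folklore] -/
theorem disjoint_tubeSides_openTube (z : Site 4) (n : ℕ) (a : {q : Fin 4 × Fin 4 // q.1 < q.2})
    (ha : (0 : Fin 4) < a.1.1) : Disjoint (tubeSides z a ha) (openTube (z + Pi.single 0 1) n a ha) := by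
  rw [Finset.disjoint_left]
  intro p hp hp'
  have h1 := (time_of_mem_tubeSides hp).1
  have h2 := time_le_of_mem_openTube hp'
  simp at h2
  omega

/-- The top cap is not a side and not the bottom cap (`n ≥ 1`); the tube has `4n + 2` faces. [folklore] -/
theorem longTube_card (z : Site 4) {n : ℕ} (hn : 1 ≤ n) (a : {q : Fin 4 × Fin 4 // q.1 < q.2})
    (ha : (0 : Fin 4) < a.1.1) : (longTube z n a ha).card = 4 * n + 2 := by
  have htop : ((z + Pi.single 0 (n : ℤ), a) : ZdPlaquette 4) ∉
      (range n).biUnion fun k => tubeSides (z + Pi.single 0 (k : ℤ)) a ha := by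
    rw [mem_biUnion]
    rintro ⟨k, -, hk⟩
    exact cap_notMem_tubeSides _ _ a ha hk
  rw [longTube, card_insert_of_notMem (bot_notMem_openTube hn), openTube, card_insert_of_notMem htop,
    card_biUnion_tubeSides]

/-- All members of the tubes have `4n + 2` elements (the `hc` bookkeeping of `pair_jet_of_class_conn`). [folklore] -/
theorem card_of_mem_longTubes (z : Site 4) {n : ℕ} (hn : 1 ≤ n) : ∀ T ∈ longTubes z n, T.card = 4 * n + 2 := by
  intro T hT
  rw [mem_longTubes] at hT
  rcases hT with rfl | rfl | rfl <;> exact longTube_card z hn _ _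

/-! ### Incidences: the faces based at the top site and at the bottom site -/

/-- **Faces at the top site.**  The only face of the tube based at `z + n e₀` is the top cap (`n ≥ 1`). [folklore] -/
theorem mk_top_mem_longTube_iff (hn : 1 ≤ n) {b : {q : Fin 4 × Fin 4 // q.1 < q.2}} :
    ((z + Pi.single 0 (n : ℤ), b) : ZdPlaquette 4) ∈ longTube z n a ha ↔ b = a := by
  constructor
  · intro h
    rw [longTube, mem_insert] at h
    rcases h with h | h
    · have := congrFun (congrArg Prod.fst h) 0
      simp at this
      omega
    · rcases time_of_mem_openTube h with h | ⟨-, k, hk, h0, -⟩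
      · exact (Prod.mk.inj h).2
      · simp at h0
        omega
  · rintro rfl
    exact mem_longTube.2 (Or.inr (Or.inl rfl))

/-- **Faces at the bottom site.**  The faces of the tube based at `z` are the bottom cap and the two sides
`(z; 0,a₁)`, `(z; 0,a₂)` (`n ≥ 1`). [folklore] -/
theorem mk_bot_mem_longTube_iff (hn : 1 ≤ n) {b : {q : Fin 4 × Fin 4 // q.1 < q.2}} :
    ((z, b) : ZdPlaquette 4) ∈ longTube z n a ha ↔
      b = a ∨ b = ⟨(0, a.1.1), ha⟩ ∨ b = ⟨(0, a.1.2), ha.trans a.2⟩ := by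
  constructor
  · intro h
    rw [longTube, mem_insert] at h
    rcases h with h | h
    · exact Or.inl (Prod.mk.inj h).2
    · rcases time_of_mem_openTube h with h | ⟨-, k, hk, h0, hp⟩
      · have := congrFun (congrArg Prod.fst h) 0
        simp at this
        omega
      · simp at h0
        subst h0
        rw [mem_tubeSides] at hp
        simp only [Nat.cast_zero, Pi.single_zero, add_zero, Prod.mk.injEq] at hp
        rcases hp with ⟨-, h⟩ | ⟨h, -⟩ | ⟨-, h⟩ | ⟨h, -⟩
        · exact Or.inr (Or.inl h)
        · exact absurd h.symm (S28DistanceTwo.add_single_ne z a.1.2)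
        · exact Or.inr (Or.inr h)
        · exact absurd h.symm (S28DistanceTwo.add_single_ne z a.1.1)
  · rintro (rfl | rfl | rfl)
    · exact mem_longTube.2 (Or.inl rfl)
    · refine mem_longTube.2 (Or.inr (Or.inr ⟨0, hn, ?_⟩))
      simp [mem_tubeSides]
    · refine mem_longTube.2 (Or.inr (Or.inr ⟨0, hn, ?_⟩))
      simp [mem_tubeSides]

/-- The two observed plaquettes differ: a plaquette based at `z + n e₀` is not one based at `z` (`n ≥ 1`). [folklore] -/
theorem mk_top_ne_mk_bot (hn : 1 ≤ n) (b b' : {q : Fin 4 × Fin 4 // q.1 < q.2}) :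
    ((z + Pi.single 0 (n : ℤ), b) : ZdPlaquette 4) ≠ (z, b') := by
  intro h
  have := congrFun (congrArg Prod.fst h) 0
  simp at this
  omega

/-! ### The region: every face of the tube is a plaquette of the corner region -/

/-- A plaquette whose four corners lie in `Λ` is a plaquette of the region `Λ`. [folklore] -/
theorem mk_mem_plaqSet {Λ : Finset (Site 4)} {x : Site 4} {b : {q : Fin 4 × Fin 4 // q.1 < q.2}} (h0 : x ∈ Λ)
    (h1 : x + Pi.single b.1.1 1 ∈ Λ) (h2 : x + Pi.single b.1.2 1 ∈ Λ)
    (h3 : x + Pi.single b.1.1 1 + Pi.single b.1.2 1 ∈ Λ) : ((x, b) : ZdPlaquette 4) ∈ plaqSet Λ := by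
  have hmem : (x, b.1.1, b.1.2) ∈ plaquettesIn Λ := by
    unfold plaquettesIn
    simp only [mem_filter, mem_product, mem_univ, and_true]
    exact ⟨h0, b.2, h1, h2, h3⟩
  unfold plaqSet
  exact mem_image.2 ⟨⟨(x, b.1.1, b.1.2), hmem⟩, mem_attach _ _, rfl⟩

/-- The corner `z + k e₀ + c` (`k ≤ n`, `c` one of the four square corners) lies in the corner region. [folklore] -/
theorem level_mem_tubeCorners {k : ℕ} (hk : k ≤ n) :
    z + Pi.single 0 (k : ℤ) ∈ tubeCorners z n a ∧ z + Pi.single 0 (k : ℤ) + Pi.single a.1.1 1 ∈ tubeCorners z n a ∧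
      z + Pi.single 0 (k : ℤ) + Pi.single a.1.2 1 ∈ tubeCorners z n a ∧
      z + Pi.single 0 (k : ℤ) + Pi.single a.1.1 1 + Pi.single a.1.2 1 ∈ tubeCorners z n a :=
  ⟨mem_tubeCorners.2 ⟨k, by omega, Or.inl rfl⟩, mem_tubeCorners.2 ⟨k, by omega, Or.inr (Or.inl rfl)⟩,
    mem_tubeCorners.2 ⟨k, by omega, Or.inr (Or.inr (Or.inl rfl))⟩,
    mem_tubeCorners.2 ⟨k, by omega, Or.inr (Or.inr (Or.inr rfl))⟩⟩

/-- The square `(z + k e₀; a)` (`k ≤ n`) is a plaquette of every region containing the corners. [folklore] -/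
theorem cap_mem_plaqSet {Λ : Finset (Site 4)} (hΛ : tubeCorners z n a ⊆ Λ) {k : ℕ} (hk : k ≤ n) :
    ((z + Pi.single 0 (k : ℤ), a) : ZdPlaquette 4) ∈ plaqSet Λ := by
  obtain ⟨h0, h1, h2, h3⟩ := level_mem_tubeCorners (z := z) (a := a) hk
  exact mk_mem_plaqSet (hΛ h0) (hΛ h1) (hΛ h2) (hΛ h3)

/-- The four sides at the level `k < n` are plaquettes of every region containing the corners. [folklore] -/
theorem tubeSides_subset_plaqSet {Λ : Finset (Site 4)} (hΛ : tubeCorners z n a ⊆ Λ) {k : ℕ} (hk : k < n) :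
    tubeSides (z + Pi.single 0 (k : ℤ)) a ha ⊆ plaqSet Λ := by
  intro p hp
  obtain ⟨h0, h1, h2, h3⟩ := level_mem_tubeCorners (z := z) (a := a) hk.le
  obtain ⟨g0, g1, g2, g3⟩ := level_mem_tubeCorners (z := z) (n := n) (a := a) (k := k + 1) (by omega)
  rw [← level_succ] at g0 g1 g2 g3
  rw [mem_tubeSides] at hp
  rcases hp with rfl | rfl | rfl | rfl
  · exact mk_mem_plaqSet (hΛ h0) (hΛ g0) (hΛ h1) (hΛ g1)
  · refine mk_mem_plaqSet (hΛ h2) (hΛ ?_) (hΛ ?_) (hΛ ?_)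
    · rw [add_right_comm]; exact g2
    · rw [add_right_comm]; exact h3
    · rw [show z + Pi.single 0 (k : ℤ) + Pi.single a.1.2 1 + Pi.single 0 1 + Pi.single a.1.1 1 =
          z + Pi.single 0 (k : ℤ) + Pi.single 0 1 + Pi.single a.1.1 1 + Pi.single a.1.2 1 by abel]
      exact g3
  · exact mk_mem_plaqSet (hΛ h0) (hΛ g0) (hΛ h2) (hΛ g2)
  · refine mk_mem_plaqSet (hΛ h1) (hΛ ?_) (hΛ h3) (hΛ ?_)
    · rw [add_right_comm]; exact g1
    · rw [show z + Pi.single 0 (k : ℤ) + Pi.single a.1.1 1 + Pi.single 0 1 + Pi.single a.1.2 1 =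
          z + Pi.single 0 (k : ℤ) + Pi.single 0 1 + Pi.single a.1.1 1 + Pi.single a.1.2 1 by abel]
      exact g3

/-- **The tube lies in every region containing its corners.** [folklore] -/
theorem longTube_subset_plaqSet {Λ : Finset (Site 4)} (hΛ : tubeCorners z n a ⊆ Λ) :
    longTube z n a ha ⊆ plaqSet Λ := by
  intro p hp
  rw [mem_longTube] at hp
  rcases hp with rfl | rfl | ⟨k, hk, hp⟩
  · have h := cap_mem_plaqSet (z := z) (a := a) hΛ (Nat.zero_le n)
    simpa using h
  · exact cap_mem_plaqSet hΛ le_rfl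
  · exact tubeSides_subset_plaqSet hΛ hk hp

/-- The three tubes lie in every region containing `longTubeRegion z n`. [folklore] -/
theorem longTubes_subset_plaqSet {Λ : Finset (Site 4)} (hΛ : longTubeRegion z n ⊆ Λ) :
    ∀ T ∈ longTubes z n, T ⊆ plaqSet Λ := by
  intro T hT
  rw [mem_longTubes] at hT
  rcases hT with rfl | rfl | rfl
  · exact longTube_subset_plaqSet fun x hx => hΛ (mem_longTubeRegion.2 (Or.inl hx))
  · exact longTube_subset_plaqSet fun x hx => hΛ (mem_longTubeRegion.2 (Or.inr (Or.inl hx)))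
  · exact longTube_subset_plaqSet fun x hx => hΛ (mem_longTubeRegion.2 (Or.inr (Or.inr hx)))

end Summit.QuantumFields.YangMills.Cruxes.NT.StrongCouplingRung.LongTube
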